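import Literature.AlgebraicGeometry.Smoothening.ForestStepData
import Mathlib.RingTheory.Localization.Module
import Mathlib.Algebra.Module.LocalizedModule.IsLocalization
import HarnessLib

/-!
# Freeness of `Ω¹_X` along the centre of a smoothening step (BLR 3.4, hypothesis of 3.3/5)

Topic: `Literature/AlgebraicGeometry/Smoothening` (Bosch–Lütkebohmert–Raynaud, *Néron Models*,
§3.3 Lemma 4 (ii): `Ω¹_{X/R}|_{U_k}` is locally free on the dense open `U_k` of the centre). In
chart coordinates: let `𝔶̃ ⊇ I` be the ideal of the centre in `B = R[T₁, …, T_N]`,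
`C = B/𝔶̃`, and `D(H)` a chart on which `𝔶̃` and `(ϖ, g)` agree, so that the centre
`C₁ = R[T, U]/𝔠` of the chart `A₁ = R[T, U]/I'` is the localisation of `C` away from `H̄`
(`ChartCentre`). If the `C`-module `C ⊗_A Ω[A⁄R]` (`A = B/I`) becomes free after inverting an
element `r̄` of `C` which is a unit in `C₁` (generic freeness, `GenericFreeness`), then
`C₁ ⊗_{A₁} Ω[A₁⁄R]` is a free `C₁`-module (`free_centre_tensor_kaehler`) — the freeness hypothesis
of `DefectDropPointwise`/`ForestStep`. The proof is a chain of base changes: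
`C₁ ⊗_{A₁} Ω[A₁] ≅ C₁ ⊗_A Ω[A] ≅ C₁ ⊗_{C_r̄} (C_r̄ ⊗_C (C ⊗_A Ω[A]))`. [folklore]; no named facts
(D-0026).

## References

* S. Bosch, W. Lütkebohmert, M. Raynaud, *Néron Models*, Springer 1990, §3.3 Lemma 4.
  [BLRNeronModels1990] (Not held; number only.)
-/

noncomputable section

open scoped TensorProduct
open MvPolynomial KaehlerDifferential

namespace Literature.AlgebraicGeometry.Smoothening

universe u

variable {R : Type u} [CommRing R] (ϖ : R) {N r : ℕ} (I 𝔶 : Ideal (MvPolynomial (Fin N) R))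
  (g : Fin r → MvPolynomial (Fin N) R) (H : MvPolynomial (Fin N) R)

local notation "A₀" => MvPolynomial (Fin N) R ⧸ I
local notation "C₀" => MvPolynomial (Fin N) R ⧸ 𝔶
local notation "A₁" => MvPolynomial (Fin (N + 1)) R ⧸ chartIdeal I H
local notation "C₁" => MvPolynomial (Fin (N + 1)) R ⧸ centreIdealB ϖ (chartGens g H)

/-- `C = B/𝔶̃` as an `A = B/I`-algebra for `I ⊆ 𝔶̃`. [folklore] -/
abbrev algebraQuotOfLE (hI𝔶 : I ≤ 𝔶) : Algebra A₀ C₀ := (Ideal.Quotient.factor hI𝔶).toAlgebra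

/-- The centre of the chart as an `A`-algebra: `A → A₁ → C₁`. [folklore] -/
abbrev algebraACentre (hle : chartIdeal I H ≤ centreIdealB ϖ (chartGens g H)) : Algebra A₀ C₁ :=
  letI := algebraQuotCentre ϖ I g H hle
  ((algebraMap A₁ C₁).comp (algebraMap A₀ A₁)).toAlgebra

/-- A module which is free after localising at `r̄` (as a localised module) is free as a base
change to the localisation. [folklore] -/
theorem free_tensor_of_free_localizedModule {C : Type u} [CommRing C] (rbar : C) (M : Type u)
    [AddCommGroup M] [Module C M]
    [Module.Free (Localization.Away rbar) (LocalizedModule.Away rbar M)] :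
    Module.Free (Localization.Away rbar) (Localization.Away rbar ⊗[C] M) :=
  Module.Free.of_equiv (IsLocalizedModule.isBaseChange (Submonoid.powers rbar)
    (Localization.Away rbar) (LocalizedModule.mkLinearMap (Submonoid.powers rbar) M)).equiv.symm

set_option synthInstance.maxHeartbeats 80000 in
set_option maxHeartbeats 400000 in
/-- **Freeness of `Ω¹_X` along the centre of the chart** from generic freeness on the centre:
if `C ⊗_A Ω[A⁄R]` becomes free over a localisation `C_r̄` of `C = B/𝔶̃` away from some `r̄` which
is a unit in the centre `C₁` of the chart, then `C₁ ⊗_{A₁} Ω[A₁⁄R]` is free over `C₁`.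
[folklore] -/
theorem free_centre_tensor_kaehler (hI𝔶 : I ≤ 𝔶)
    (h𝔶 : ∀ y ∈ 𝔶, H * y ∈ centreIdealB ϖ g)
    (hIg : ∀ x ∈ I, H * x ∈ centreIdealB ϖ g)
    (rbar : C₀) (Cr : Type u) [CommRing Cr] [Algebra C₀ Cr] [IsLocalization.Away rbar Cr]
    (hr : letI := algebraCentre ϖ g H 𝔶 h𝔶; IsUnit (algebraMap C₀ C₁ rbar))
    (hfree : letI := algebraQuotOfLE I 𝔶 hI𝔶; Module.Free Cr (Cr ⊗[C₀] (C₀ ⊗[A₀] Ω[A₀⁄R]))) :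
    letI := algebraQuotCentre ϖ I g H (chartIdeal_le_centre ϖ I g H hIg)
    Module.Free C₁ (C₁ ⊗[A₁] Ω[A₁⁄R]) := by
  have hle := chartIdeal_le_centre ϖ I g H hIg
  letI := algebraQuotCentre ϖ I g H hle
  haveI := isScalarTower_quotCentre ϖ I g H hle
  letI := algebraQuotOfLE I 𝔶 hI𝔶
  letI := algebraCentre ϖ g H 𝔶 h𝔶
  letI := algebraACentre ϖ I g H hle
  haveI : IsScalarTower A₀ A₁ C₁ :=
    IsScalarTower.of_algebraMap_eq (R := A₀) (S := A₁) (A := C₁) fun _ => rfl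
  haveI : IsScalarTower A₀ C₀ C₁ :=
    IsScalarTower.of_algebraMap_eq (R := A₀) (S := C₀) (A := C₁) fun x => by
      obtain ⟨b, rfl⟩ := Ideal.Quotient.mk_surjective x
      change algebraMap A₁ C₁ (algebraMap A₀ A₁ (Ideal.Quotient.mk I b)) = _
      rw [algebraMap_chart_mk]
      rfl
  -- `C_r̄ → C₁` and `A → C_r̄`
  letI : Algebra Cr C₁ := (IsLocalization.Away.lift rbar (g := algebraMap C₀ C₁) hr).toAlgebra
  haveI : IsScalarTower C₀ Cr C₁ := IsScalarTower.of_algebraMap_eq (R := C₀) (S := Cr) (A := C₁)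
    fun x => (IsLocalization.Away.lift_eq rbar (g := algebraMap C₀ C₁) hr x).symm
  letI : Algebra A₀ Cr := ((algebraMap C₀ Cr).comp (algebraMap A₀ C₀)).toAlgebra
  haveI : IsScalarTower A₀ C₀ Cr :=
    IsScalarTower.of_algebraMap_eq (R := A₀) (S := C₀) (A := Cr) fun _ => rfl
  haveI : IsScalarTower A₀ Cr C₁ := IsScalarTower.of_algebraMap_eq (R := A₀) (S := Cr) (A := C₁)
    fun x => by
      rw [IsScalarTower.algebraMap_apply A₀ C₀ Cr, ← IsScalarTower.algebraMap_apply C₀ Cr C₁,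
        ← IsScalarTower.algebraMap_apply A₀ C₀ C₁]
  -- the free `C_r̄`-module `C_r̄ ⊗_A Ω[A]`
  haveI : Module.Free Cr (Cr ⊗[A₀] Ω[A₀⁄R]) :=
    Module.Free.of_equiv (TensorProduct.AlgebraTensorModule.cancelBaseChange A₀ C₀ Cr Cr Ω[A₀⁄R])
  -- `C₁ ⊗_{A₁} Ω[A₁] ≅ C₁ ⊗_A Ω[A] ≅ C₁ ⊗_{C_r̄} (C_r̄ ⊗_A Ω[A])`
  haveI : IsLocalizedModule (Submonoid.powers (Ideal.Quotient.mk I H))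
      (KaehlerDifferential.map R R A₀ A₁) := inferInstance
  let e₁ : A₁ ⊗[A₀] Ω[A₀⁄R] ≃ₗ[A₁] Ω[A₁⁄R] :=
    (IsLocalizedModule.isBaseChange (Submonoid.powers (Ideal.Quotient.mk I H)) A₁
      (KaehlerDifferential.map R R A₀ A₁)).equiv
  let e₂ : C₁ ⊗[A₁] Ω[A₁⁄R] ≃ₗ[C₁] C₁ ⊗[A₀] Ω[A₀⁄R] :=
    (TensorProduct.AlgebraTensorModule.congr (LinearEquiv.refl C₁ C₁) e₁.symm).trans
      (TensorProduct.AlgebraTensorModule.cancelBaseChange A₀ A₁ C₁ C₁ Ω[A₀⁄R])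
  let e₃ : C₁ ⊗[A₀] Ω[A₀⁄R] ≃ₗ[C₁] C₁ ⊗[Cr] (Cr ⊗[A₀] Ω[A₀⁄R]) :=
    (TensorProduct.AlgebraTensorModule.cancelBaseChange A₀ Cr C₁ C₁ Ω[A₀⁄R]).symm
  exact Module.Free.of_equiv (e₂.trans e₃).symm

end Literature.AlgebraicGeometry.Smoothening

end
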